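import Summits.QuantumFields.BalabanUV.T4Continuum.Spine.NE5.TwoRunTorusNE5Nonvacuous

/-!
# Spine/NE5/TwoRunTorusNE5Usable — the minimal END of row NE5 re-exported with the constants' clauses a producer
# needs (`1 ≤ κ₁`, the (2.18) contour clause): the ∃∀ statement of T41 made INSTANTIABLE (cell `pub-balaban-gaps`,
# seat `ne5` gen 13; located point (x14) repaired; companion `TwoRunTorusNE5Fires` instantiates it)

WHY.  T41 `TwoRunTorusNE5Nonvacuous.ne5_of_structural_data(_abs)` (✓ p392538) has the shape `∃ (c, M, w, α, γ₂, r_P,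
a₂₀, w₀), (letters) ∧ ∀ (structural data …), NE5 …`.  Its ∀-part asks the producer for a contour radius
`0 < r ≤ e^{c.κ₁} − 1` and for τ-regions containing the closed discs of radius `(invTau c (d_k Y))⁻¹` ((2.18) p. 16),
but its ∃-part exports NOTHING about `c.κ₁` or `invTau c` — so AS STATED the ∀-part may be vacuous in `r` (take any
`c.κ₁ ≤ 0`): neither a consumer nor a producer can instantiate T41 (located point (x14) of `ne/NE5.md` §19, found when
writing the instantiation `TwoRunTorusNE5Fires.end_fires`).  The repair costs nothing: r10's witness
`B13Lemma3TorusNonvacuity.numerics_nonvacuous_pos` (✓ p392209) already carries `1 ≤ c.κ₁` and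
`∀ d ≥ 0, 0 < invTau c d ≤ ½`; T41's proof discarded them after use.  THIS FILE re-exports them:
`ne5_of_structural_data_usable` = T41's statement with the two clauses added to the ∃-part (proof = T41's: T39
`ne5_of_records_symm_all_scales` fed by T40 `scalars_of_rates` and the witness), and `ne5_of_structural_data_usable_abs`
= the same fed with `numerics_nonvacuous_pos` — the form a producer (NODE O's (v)⁺ with rows NE2∕NE3's rate) invokes:
pick `L := c.L`, any torus family, `Uτ j Y ⊇ closedBall 0 (invTau c (d_k Y))⁻¹ ∪ ⋃_{ζ∈[0,1]} closedBall ζ r` with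
`r := e^{κ₁} − 1 > 0`, and the END's conclusion is `T4OutputRate.NE5` BY NAME.

HONEST FRAMING.  Interface repair over landed shapes (one ∃ re-packed); nothing of Bałaban's is constructed or asserted
beyond print.  NE5 NOT PRINTED ∕ NOT PROVED; leaves 0∕12; (D4) 0∕1; spine 0∕9.  Rung (B)+1 on a FIXED finite T⁴ — NOT
continuum, NOT infinite volume, NOT mass gap, NOT Clay.  HONEST DEPENDENCY: continuum YM on T⁴ ⇐ BetaPertH ∧ nine
spine estimates; BetaPertH ⇐ (D1) ∧ (D4) ∧ CAP+tail.  0 sorry, 0 `def`.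

Sources: [II] = T. Bałaban, CMP **116** (1988) [Balaban1988RG2Cluster] (2.13)–(2.26) pp. 14–17, (2.18) p. 16, Lemma 3
(2.38) p. 20, p. 21 («The assumptions allow finally us to fix all the constants»); [I] = CMP **109** (1987)
[Balaban1987RG1] (0.24)–(0.25) p. 257; [B9] = CMP **99** (1985) [Balaban1985BackgroundPropagators] Thm 3.10 p. 416.
Nothing here is a claim about the Yang–Mills mass gap.
-/

noncomputable section

namespace Summit.QuantumFields.BalabanUV.T4Continuum.Spine.NE5.TwoRunTorusNE5Usable

open Matrix Metric Set Finset
open Literature.MathematicalPhysics.QuantumFieldTheory.Balaban1983to89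
open Literature.MathematicalPhysics.QuantumFieldTheory.Balaban1983to89.T4OutputRate (NE5)
open Literature.MathematicalPhysics.QuantumFieldTheory.Balaban1983to89.TreeLengthTorus (TPt TDom tsys)
open Literature.MathematicalPhysics.QuantumFieldTheory.Balaban1983to89.TreeLengthTorusGeometry (TTouch)
open Literature.MathematicalPhysics.QuantumFieldTheory.Balaban1983to89.TreeLengthTorusTransfer (tclosure)
open Literature.MathematicalPhysics.QuantumFieldTheory.Balaban1983to89.B13Lemma3TorusData (TBond)
open Literature.MathematicalPhysics.QuantumFieldTheory.Balaban1983to89.B13Lemma3Torus (TwoTorusStep)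
open Literature.MathematicalPhysics.QuantumFieldTheory.Balaban1983to89.B13Lemma3TorusTerms (terms weight Z0)
open Literature.MathematicalPhysics.QuantumFieldTheory.Balaban1983to89.B13Term214 (core214 F214 term214)
open Literature.MathematicalPhysics.QuantumFieldTheory.Balaban1983to89.B13Bound143 (invTau)
open Literature.MathematicalPhysics.QuantumFieldTheory.Balaban1983to89.B5TorusCover (UT)
open Literature.MathematicalPhysics.QuantumFieldTheory.Balaban1983to89.B12TreeDecay (kappa₀ K₀)
open Literature.MathematicalPhysics.QuantumFieldTheory.Balaban1983to89.B13Resummation (locE)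
open Literature.MathematicalPhysics.QuantumFieldTheory.Balaban1983to89.B13TermWalkData
  (WalkConsts TermKernels TermWalkData)
open Summit.QuantumFields.BalabanUV.T4Continuum.Spine.NE5.TwoRunTorusNE5Records (ne5_of_records_symm_all_scales)
open Summit.QuantumFields.BalabanUV.T4Continuum.Spine.NE5.TwoRunTorusNE5Scalars (scalars_of_rates)
open Summit.QuantumFields.BalabanUV.T4Continuum.Spine.NE5.TwoRunTorusNE5 (torusCarriers reFunctional)
open Literature.MathematicalPhysics.QuantumFieldTheory.Balaban1983to89.B13Lemma3TorusNonvacuity (numerics_nonvacuous_pos)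

variable {ν : ℕ} {Nf : ℕ → Fin ν → ℕ} [∀ j i, NeZero (Nf j i)]

open Classical in
/-- **THE USABLE END** — T41 `ne5_of_structural_data` with two more EXPORTED clauses on the constants: `1 ≤ c.κ₁` (so a
contour radius `0 < r ≤ e^{κ₁} − 1` exists) and the (2.18) clause `∀ d ≥ 0, 0 < invTau c d ≤ ½` (so the τ-discs the
regions must contain are known discs).  Everything else verbatim T41: from a Lemma-3 witness with positive volume
constant and the O(1) letters there exist `c, M, w j, α j, γ₂, r_P, a₂₀, w₀` such that for EVERY family of torus models,
τ-regions, contour radius, parameter lists, walk records at `c⁺` with `TermWalkData`, σ-holomorphy, symmetry,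
potentials with (2.20), `χ` with (2.22), fibre ∕ size bounds, activities by summation and outputs by (2.13):
`NE5 (torus carriers) … ((1−10δ)½Lκ) θ (2A₂C₃ε₁∕s)`.  Proof: T39 fed by T40 and the witness, as in T41.
[cite: Balaban1987RG1, (0.24)–(0.25) p.257; Balaban1988RG2Cluster, (2.13)–(2.26) pp.14–17, (2.18) p.16, (2.38) p.20, p.21; Balaban1985BackgroundPropagators, Thm 3.10 p.416] -/
theorem ne5_of_structural_data_usable
    (hL3 : ∃ (c : B13.Consts) (M : ℕ) (a a₂ a₂' a₅ Aabs Bc : ℝ),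
      8 ≤ c.L ∧ 0 < M ∧ 0 < c.ε₁ ∧ 0 < c.α₆ ∧ 0 ≤ c.eps2 ∧ 0 ≤ c.δ ∧ 0 ≤ 1 - 7 * c.δ ∧ 0 ≤ c.κ ∧ 0 ≤ a ∧
      c.R15 ∧ 18 * ((1 - 4 * c.δ) * c.κ) ≤ a / 20 ∧ 4 * c.κ ≤ a / 20 ∧ Real.exp (-(a / 20)) ≤ c.eps2 ∧
      2 * (4 : ℝ) * (M : ℝ) ^ 4 * Real.exp (-(a / 10)) ≤ a / 20 ∧
      0 ≤ a₂ ∧ kappa₀ 64 8 + a₂ ≤ c.δ * c.κ ∧ c.α₆ * Real.exp a₂ * K₀ 64 8 * 64 ≤ a₂ ∧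
      Real.exp (-(a / 20)) * 64 ≤ c.δ * c.κ ∧
      B13Step237.R18half c (K₀ 64 8 * Real.exp (Real.exp (-(a / 20)) * 64)) ∧
      B13Step237.R18sharp c (K₀ 64 8 * Real.exp (Real.exp (-(a / 20)) * 64)) ((c.L : ℝ) / 2) ∧
      0 ≤ a₂' ∧ kappa₀ 64 8 + a₂' ≤ c.δ * ((c.L : ℝ) / 2) * c.κ ∧ c.α₆ * Real.exp a₂' * K₀ 64 8 * 64 ≤ a₂' ∧
      18 * ((1 - 7 * c.δ) * ((c.L : ℝ) / 2) * c.κ) ≤ (c.κ₁ - 1) / 2 ∧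
      0 ≤ a₅ ∧ a₅ + Real.exp (-((c.κ₁ - 1) / 2)) ≤ Aabs ∧ Aabs * 64 ≤ c.δ * ((c.L : ℝ) / 2) * c.κ ∧
      B13Step237.bracketF c (K₀ 64 8 * Real.exp (Real.exp (-(a / 20)) * 64)) / c.α₆ * Real.exp (Aabs * 64) ≤
      c.C3act * c.ε₁ ∧
      0 ≤ c.C3act * c.ε₁ ∧ c.κ + 2 * (64 * Real.log 162) + 2 ≤ (1 - 8 * c.δ) * ((c.L : ℝ) / 2) * c.κ ∧
      c.C3act * c.ε₁ * Real.exp (5 * c.κ + 1) * K₀ 64 8 * 9 * 64 ≤ 1 ∧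
      Real.exp 1 * 9 * 64 * K₀ 64 8 ^ 2 ≤ c.A₂ ∧ c.R22 ∧ c.R23 ∧ c.R24sharp ∧ 0 ≤ c.E₀ ∧
      0 ≤ Bc ∧ Bc * 64 ≤ c.E₀ / 2 ∧
      0 < a₅ ∧ 1 ≤ c.κ₁ ∧ (∀ d : ℝ, 0 ≤ d → 0 < invTau c d ∧ invTau c d ≤ 1 / 2))
    {KΓ KE KC ε κ : ℝ} (hKΓ : 0 ≤ KΓ) (hKE : 0 ≤ KE) (hKC : 0 ≤ KC) (hε : 0 < ε) (hκ : 0 < κ) (m : ℕ)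
    {nΛ nN : ℝ} (hnΛ : 0 ≤ nΛ) (hnN : 0 ≤ nN)
    {θ s : ℝ} (hθ : 0 < θ) (hs : 0 < s) (Rσ₀ : ℝ) :
    ∃ (c : B13.Consts) (M : ℕ) (_ : NeZero M) (w : ℕ → WalkConsts) (α : ℕ → ℝ) (γ₂ rP a₂₀ w₀ : ℝ),
      8 ≤ c.L ∧ 1 ≤ c.κ₁ ∧ (∀ d : ℝ, 0 ≤ d → 0 < invTau c d ∧ invTau c d ≤ 1 / 2) ∧
      (∀ j, (w j).Admissible (α j) Rσ₀) ∧ (∀ j, 1 < α j) ∧ (∀ j, θ ^ j < s → s / θ ^ j ≤ α j) ∧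
      (∀ j, (w j).KbarΓ = KΓ ∧ (w j).KbarE = KE ∧ (w j).KbarC = KC ∧ (w j).kap = κ ∧ (w j).ε = ε) ∧
      0 < γ₂ ∧ 0 ≤ a₂₀ ∧ 0 < w₀ ∧
      ∀ {L : ℕ} [NeZero L], c.L = L → ∀ (N : ℕ → ℕ) [∀ j, NeZero (N j)] (W : (j : ℕ) → TwoTorusStep 4 L (N j))
        {Uτ : (j : ℕ) → TDom 4 (L * N j) → Set ℂ}, (∀ j Y, IsOpen (Uτ j Y)) →
        (∀ j, ∀ Y : TDom 4 (L * N j), closedBall (0 : ℂ) ((invTau c ((tsys 4 (L * N j)).dj Y))⁻¹) ⊆ Uτ j Y) →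
        ∀ {r : ℝ}, 0 < r → r ≤ Real.exp c.κ₁ - 1 → (∀ j Y, ∀ ζ ∈ Set.uIcc (0 : ℝ) 1, closedBall (ζ : ℂ) r ⊆ Uτ j Y) →
        ∀ (lZ : (j : ℕ) → TDom 4 (N j) → Finset (TDom 4 (L * N j)) × Finset (TBond 4 M (L * N j)) → List (TPt 4 (N j))),
        (∀ j Z t, (lZ j Z t).Nodup ∧ (lZ j Z t).toFinset = Z.1 \ tclosure L (N j) (Z0 M t)) →
        ∀ (lD : (j : ℕ) → Finset (TDom 4 (L * N j)) × Finset (TBond 4 M (L * N j)) → List (TDom 4 (L * N j))),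
        (∀ j t, (lD j t).Nodup ∧ (lD j t).toFinset = t.1) →
        ∀ (𝒦 : (j : ℕ) → (Z : TDom 4 (N j)) → Finset (TDom 4 (L * N j)) × Finset (TBond 4 M (L * N j)) → (W j).Φ →
            TermKernels ({ c with κ₁ := c.κ₁ + 1 } : B13.Consts) 4 (N j) ν (Nf j) ℂ)
          [∀ j Z t φ, Fintype (𝒦 j Z t φ).C₀] [∀ j Z t φ, DecidableEq (𝒦 j Z t φ).C₀],
        (∀ j Z, ∀ t ∈ terms L M Z, ∀ φ, φ ∈ (W j).sp2 Z → TermWalkData (𝒦 j Z t φ) (w j)) →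
        ∀ (Γ : (j : ℕ) → (Z : TDom 4 (N j)) → (t : Finset (TDom 4 (L * N j)) × Finset (TBond 4 M (L * N j))) →
            (φ : (W j).Φ) → ℂ → (TPt 4 (N j) → ℂ) → ((𝒦 j Z t φ).Λ ⊕ (𝒦 j Z t φ).C₀ → ℝ) → ((𝒦 j Z t φ).Λ → ℂ)),
        (∀ j Z, ∀ t ∈ terms L M Z, ∀ φ, φ ∈ (W j).sp2 Z → ∀ b ∈ ball (0 : ℂ) (α j), ∀ σ : TPt 4 (N j) → ℂ,
          (∀ i, σ i ∈ ball (0 : ℂ) (Real.exp (c.κ₁ + 1))) →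
            ∀ X : (𝒦 j Z t φ).Λ ⊕ (𝒦 j Z t φ).C₀ → ℝ, Γ j Z t φ b σ X = (𝒦 j Z t φ).G2 σ b *ᵥ fun i => (X i : ℂ)) →
        ∀ (χY₀ χcP : (j : ℕ) → (Z : TDom 4 (N j)) → (t : Finset (TDom 4 (L * N j)) × Finset (TBond 4 M (L * N j))) →
            (φ : (W j).Φ) → ((𝒦 j Z t φ).Λ → ℝ) → ℝ),
        (∀ j Z t φ Bf, 0 ≤ χY₀ j Z t φ Bf) → (∀ j Z t φ Bf, 0 ≤ χcP j Z t φ Bf) →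
        ∀ (Dfam : (j : ℕ) → TDom 4 (N j) → Finset (TDom 4 (L * N j)) × Finset (TBond 4 M (L * N j)) →
            Finset (TDom 4 (L * N j)))
          (Vk : (j : ℕ) → (Z : TDom 4 (N j)) → (t : Finset (TDom 4 (L * N j)) × Finset (TBond 4 M (L * N j))) →
            (φ : (W j).Φ) → ℂ → TDom 4 (L * N j) → ((𝒦 j Z t φ).Λ → ℝ) → ℂ),
        (∀ j Z, ∀ t ∈ terms L M Z, ∀ φ, φ ∈ (W j).sp2 Z → ∀ b ∈ ball (0 : ℂ) (α j), ∀ i i',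
          DifferentiableOn ℂ (fun σ => (𝒦 j Z t φ).A2 σ b i i') {σ | ∀ i, σ i ∈ ball (0 : ℂ) (Real.exp (c.κ₁ + 1))}) →
        (∀ j Z, ∀ t ∈ terms L M Z, ∀ φ, φ ∈ (W j).sp2 Z → ∀ b ∈ ball (0 : ℂ) (α j), ∀ i i',
          DifferentiableOn ℂ (fun σ => (𝒦 j Z t φ).G2 σ b i i') {σ | ∀ i, σ i ∈ ball (0 : ℂ) (Real.exp (c.κ₁ + 1))}) →
        (∀ j Z, ∀ t ∈ terms L M Z, ∀ φ, φ ∈ (W j).sp2 Z → ∀ Y Bf,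
          DifferentiableOn ℂ (fun b => Vk j Z t φ b Y Bf) (ball (0 : ℂ) (α j))) →
        (∀ j Z t φ, Measurable (χY₀ j Z t φ)) → (∀ j Z t φ, Measurable (χcP j Z t φ)) →
        (∀ j Z, ∀ t ∈ terms L M Z, ∀ φ, φ ∈ (W j).sp2 Z → ∀ b ∈ ball (0 : ℂ) (α j), ∀ Y,
          Measurable (Vk j Z t φ b Y)) →
        (∀ j Z, ∀ t ∈ terms L M Z, ∀ φ, φ ∈ (W j).sp2 Z → ∀ b : ℂ, ‖b‖ ≤ α j → ∀ σ : TPt 4 (N j) → ℂ,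
          (∀ i, ‖σ i‖ ≤ Real.exp (c.κ₁ + 1)) → ((𝒦 j Z t φ).A2 σ b).IsSymm) →
        ∀ {w₂₀ : ℝ} (qP : (j : ℕ) → (Z : TDom 4 (N j)) → (t : Finset (TDom 4 (L * N j)) × Finset (TBond 4 M (L * N j))) →
            (φ : (W j).Φ) → ((𝒦 j Z t φ).Λ → ℝ) → ℝ),
        (∀ j Z t φ Bf, χY₀ j Z t φ Bf * χcP j Z t φ Bf ≤
          Real.exp (-(γ₂ / 2 * rP ^ 2 * (t.2.card : ℕ)) + γ₂ / 2 * qP j Z t φ Bf)) →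
        (∀ j Z t φ Bf, qP j Z t φ Bf ≤ Bf ⬝ᵥ Bf) →
        (∀ j Z, ∀ t ∈ terms L M Z, ∀ φ, φ ∈ (W j).sp2 Z → ∀ b ∈ ball (0 : ℂ) (α j),
          ∀ τ : TDom 4 (L * N j) → ℂ, (∀ Y, τ Y ∈ Uτ j Y) →
            ∀ Bf, ∑ Y ∈ Dfam j Z t, ‖τ Y‖ * ‖Vk j Z t φ b Y Bf‖ ≤ a₂₀ / 2 * (Bf ⬝ᵥ Bf) + w₂₀) →
        (∀ j, ∀ Z : TDom 4 (N j), w₂₀ ≤ w₀ * ((Z.1).card : ℝ)) →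
        (∀ j Z t φ, (𝒦 j Z t φ).m ≤ m) →
        (∀ j Z t φ, ∀ x : UT (Nf j), (Finset.univ.filter fun i => (𝒦 j Z t φ).locN i = x).card ≤ m) →
        (∀ j Z t φ, (Fintype.card (𝒦 j Z t φ).Λ : ℝ) ≤ nΛ * ((Z.1).card : ℝ)) →
        (∀ j Z t φ, (Fintype.card ((𝒦 j Z t φ).Λ ⊕ (𝒦 j Z t φ).C₀) : ℝ) ≤ nN * ((Z.1).card : ℝ)) →
        ∀ {H : (j : ℕ) → ℂ → TDom 4 (N j) → (W j).Φ → ℂ},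
        (∀ j, ∀ b ∈ ball (0 : ℂ) (α j), ∀ (Z : TDom 4 (N j)) (φ : (W j).Φ), φ ∈ (W j).sp2 Z →
          H j b Z φ = ∑ t ∈ terms L M Z,
            term214 r (lZ j Z t) (lD j t) (core214 (fun σ => (𝒦 j Z t φ).A2 σ b) (Γ j Z t φ b)
              (F214 t.2.card (χY₀ j Z t φ) (χcP j Z t φ) (Dfam j Z t) (Vk j Z t φ b))) 0 0) →
        (∀ j, ∀ X Z : TDom 4 (N j), ∀ φ, Z.1 ⊆ X.1 → φ ∈ (W j).sp2 X → φ ∈ (W j).sp2 Z) →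
        ∀ {E : (j : ℕ) → ℂ → TDom 4 (N j) → (W j).Φ → ℂ},
        (∀ j, ∀ b ∈ ball (0 : ℂ) (α j), ∀ (X : TDom 4 (N j)) (φ : (W j).Φ), φ ∈ (W j).sp2 X →
          E j b X φ = locE (TTouch (d := 4) (N := N j)) (fun Z : TDom 4 (N j) => Z.1) (fun Z => H j b Z φ) X.1) →
        ∀ W' : Set (ℕ → ℝ),
        NE5 (C := torusCarriers N W) (reFunctional N W fun j => E j 0) (reFunctional N W fun j => E j 1) W'
          ((1 - 10 * c.δ) * ((c.L : ℝ) / 2) * c.κ) θ (2 * (c.A₂ * c.C3act * c.ε₁) / s) := by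
  obtain ⟨c, M, a, a₂, a₂', a₅, Aabs, Bc, hL, hM, -, hα₆, hε₀, hδ, hδ7, hκc, ha, hR15, hR16, hR16', hR17, h231,
    ha₂, hκ229, hsm229, habsk, h18half, h18, ha₂', hκ229', hsm229', hR20, ha₅0, habs, hAc, hC3, hAct, hlarge,
    hsmall41, hA₂, hR22, -, -, -, -, -, ha₅, hκ₁, hτ⟩ := hL3
  -- T40: every non-Lemma-3 scalar letter, rate chain 4κ∕5 > 3κ∕5 > 2κ∕5 > κ∕5
  have hκa : 4 * κ / 5 < κ := by linarith
  have hκb : 3 * κ / 5 < 4 * κ / 5 := by linarith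
  have h2 : 2 * κ / 5 < 3 * κ / 5 := by linarith
  have h1 : κ / 5 < 2 * κ / 5 := by linarith
  have h0 : 0 < κ / 5 := by linarith
  obtain ⟨w, α, ϑ, cE, g, γ₂, a₂₀, w₀, rP, hw, hα1, hαs, hsm, hκaw, hlett, -, -, -, hR1, hKθ, hcEj, hgEj, hRe,
    hγ₂, ha₂₀, hαc, hsmallG, hPa, hw₀, hvol⟩ :=
    scalars_of_rates θ s Rσ₀ hKΓ hKE hKC hε hκ (Nat.cast_nonneg m) ν hκa hκb h2 h1 h0 hnΛ hnN ha ha₅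
  haveI hMz : NeZero M := ⟨hM.ne'⟩
  refine ⟨c, M, hMz, w, α, γ₂, rP, a₂₀, w₀, hL, hκ₁, hτ, hw, hα1, hαs, hlett, hγ₂, ha₂₀, hw₀, ?_⟩
  intro L _ hLc N _ W Uτ hUτ hUtau r hr hr' hsubτ lZ hlZ lD hlD 𝒦 _ _ h𝒦 Γ hlin χY₀ χcP hχ0 hχc0 Dfam Vk hAhol
    hGhol hVholb hχm hχcm hVm hAs w₂₀ qP h222 hqP h220U hw₂₀ hm hfibN hΛ hN H hH hsp E h213 W'
  -- R22: `(1 − 10δ)·½L = 1`, so the closing numerics read at `κ`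
  have h22 : (1 - 10 * c.δ) * ((c.L : ℝ) / 2) = 1 := hR22
  have hmul : (1 - 10 * c.δ) * ((c.L : ℝ) / 2) * c.κ = c.κ := by rw [h22, one_mul]
  exact ne5_of_records_symm_all_scales c hL hLc hκ₁ hα₆.ne' N W hθ hs
    (fun j Y => (hτ _ ((tsys 4 (L * N j)).dj_nonneg Y)).1) (fun j Y => (hτ _ ((tsys 4 (L * N j)).dj_nonneg Y)).2)
    hUτ hUtau hr hr' hsubτ lZ hlZ lD hlD 𝒦 hw hα1 hαs h𝒦 Γ hlin χY₀ χcP hχ0 hχc0 Dfam Vk hAhol hGhol hVholb hχm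
    hχcm hVm hAs qP h222 hγ₂.le hqP ha₂₀ h220U hm hfibN hκaw hκb h2 h1 h0 hsm
    (fun j Z t φ => hR1 j _ (Nat.cast_nonneg _) (Nat.cast_le.2 (hm j Z t φ))) hKθ hcEj hgEj hRe hαc hsmallG hPa
    (fun j Z t _ φ _ => hvol j _ _ _ _ (Nat.cast_nonneg _) (Nat.cast_nonneg _) (Nat.cast_nonneg _) (hΛ j Z t φ)
      (hN j Z t φ) (hw₂₀ j Z))
    hα₆ hε₀ hδ hδ7 hκc ha hR15 hR16 hR16' hR17 h231 ha₂ hκ229 hsm229 habsk h18half h18 ha₂' hκ229' hsm229' hR20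
    ha₅0 habs hAc hC3 hH hsp h213 hAct (by rw [hmul]; exact hκc) (by rw [hmul]; exact hlarge)
    (by rw [hmul]; exact hsmall41) hA₂ W'

open Classical in
/-- **THE USABLE END, ABSOLUTE FORM** — `ne5_of_structural_data_usable` fed with the tree's Lemma-3 witness
`B13Lemma3TorusNonvacuity.numerics_nonvacuous_pos` (r10 gen 44, ✓ p392209; `a₅ = ½`, `M = 1`, `L = 8`).  For ANY O(1)
letters `K̄_Γ, K̄_E, K̄_C ≥ 0`, `ε, κ > 0`, `m`, `n_Λ, n_N ≥ 0`, `θ, s > 0`, `R_σ0` there EXIST `c` with `8 ≤ c.L`,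
`1 ≤ c.κ₁` and the (2.18) clause, `M`, `w`, `α`, `γ₂`, `r_P`, `a₂₀`, `w₀` such that every family of structural data
meeting T39's structural hypotheses at these letters yields `T4OutputRate.NE5 … ((1−10δ)½Lκ) θ (2A₂C₃ε₁∕s)` BY NAME —
and this time the ∀-part IS instantiable (`TwoRunTorusNE5Fires.end_fires` does it on an explicit producer).  (Honest:
consistency ∕ usability of the typed chain, not the size of Bałaban's constants; leaves 0∕12.)
[cite: Balaban1988RG2Cluster, p.21 («The assumptions allow finally us to fix all the constants»), (2.13)–(2.26) pp.14–17, (2.18) p.16, (2.38) p.20, (2.41) p.21; Balaban1987RG1, (0.24)–(0.25) p.257] -/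
theorem ne5_of_structural_data_usable_abs
    {KΓ KE KC ε κ : ℝ} (hKΓ : 0 ≤ KΓ) (hKE : 0 ≤ KE) (hKC : 0 ≤ KC) (hε : 0 < ε) (hκ : 0 < κ) (m : ℕ)
    {nΛ nN : ℝ} (hnΛ : 0 ≤ nΛ) (hnN : 0 ≤ nN)
    {θ s : ℝ} (hθ : 0 < θ) (hs : 0 < s) (Rσ₀ : ℝ) :
    ∃ (c : B13.Consts) (M : ℕ) (_ : NeZero M) (w : ℕ → WalkConsts) (α : ℕ → ℝ) (γ₂ rP a₂₀ w₀ : ℝ),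
      8 ≤ c.L ∧ 1 ≤ c.κ₁ ∧ (∀ d : ℝ, 0 ≤ d → 0 < invTau c d ∧ invTau c d ≤ 1 / 2) ∧
      (∀ j, (w j).Admissible (α j) Rσ₀) ∧ (∀ j, 1 < α j) ∧ (∀ j, θ ^ j < s → s / θ ^ j ≤ α j) ∧
      (∀ j, (w j).KbarΓ = KΓ ∧ (w j).KbarE = KE ∧ (w j).KbarC = KC ∧ (w j).kap = κ ∧ (w j).ε = ε) ∧
      0 < γ₂ ∧ 0 ≤ a₂₀ ∧ 0 < w₀ ∧
      ∀ {L : ℕ} [NeZero L], c.L = L → ∀ (N : ℕ → ℕ) [∀ j, NeZero (N j)] (W : (j : ℕ) → TwoTorusStep 4 L (N j))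
        {Uτ : (j : ℕ) → TDom 4 (L * N j) → Set ℂ}, (∀ j Y, IsOpen (Uτ j Y)) →
        (∀ j, ∀ Y : TDom 4 (L * N j), closedBall (0 : ℂ) ((invTau c ((tsys 4 (L * N j)).dj Y))⁻¹) ⊆ Uτ j Y) →
        ∀ {r : ℝ}, 0 < r → r ≤ Real.exp c.κ₁ - 1 → (∀ j Y, ∀ ζ ∈ Set.uIcc (0 : ℝ) 1, closedBall (ζ : ℂ) r ⊆ Uτ j Y) →
        ∀ (lZ : (j : ℕ) → TDom 4 (N j) → Finset (TDom 4 (L * N j)) × Finset (TBond 4 M (L * N j)) → List (TPt 4 (N j))),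
        (∀ j Z t, (lZ j Z t).Nodup ∧ (lZ j Z t).toFinset = Z.1 \ tclosure L (N j) (Z0 M t)) →
        ∀ (lD : (j : ℕ) → Finset (TDom 4 (L * N j)) × Finset (TBond 4 M (L * N j)) → List (TDom 4 (L * N j))),
        (∀ j t, (lD j t).Nodup ∧ (lD j t).toFinset = t.1) →
        ∀ (𝒦 : (j : ℕ) → (Z : TDom 4 (N j)) → Finset (TDom 4 (L * N j)) × Finset (TBond 4 M (L * N j)) → (W j).Φ →
            TermKernels ({ c with κ₁ := c.κ₁ + 1 } : B13.Consts) 4 (N j) ν (Nf j) ℂ)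
          [∀ j Z t φ, Fintype (𝒦 j Z t φ).C₀] [∀ j Z t φ, DecidableEq (𝒦 j Z t φ).C₀],
        (∀ j Z, ∀ t ∈ terms L M Z, ∀ φ, φ ∈ (W j).sp2 Z → TermWalkData (𝒦 j Z t φ) (w j)) →
        ∀ (Γ : (j : ℕ) → (Z : TDom 4 (N j)) → (t : Finset (TDom 4 (L * N j)) × Finset (TBond 4 M (L * N j))) →
            (φ : (W j).Φ) → ℂ → (TPt 4 (N j) → ℂ) → ((𝒦 j Z t φ).Λ ⊕ (𝒦 j Z t φ).C₀ → ℝ) → ((𝒦 j Z t φ).Λ → ℂ)),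
        (∀ j Z, ∀ t ∈ terms L M Z, ∀ φ, φ ∈ (W j).sp2 Z → ∀ b ∈ ball (0 : ℂ) (α j), ∀ σ : TPt 4 (N j) → ℂ,
          (∀ i, σ i ∈ ball (0 : ℂ) (Real.exp (c.κ₁ + 1))) →
            ∀ X : (𝒦 j Z t φ).Λ ⊕ (𝒦 j Z t φ).C₀ → ℝ, Γ j Z t φ b σ X = (𝒦 j Z t φ).G2 σ b *ᵥ fun i => (X i : ℂ)) →
        ∀ (χY₀ χcP : (j : ℕ) → (Z : TDom 4 (N j)) → (t : Finset (TDom 4 (L * N j)) × Finset (TBond 4 M (L * N j))) →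
            (φ : (W j).Φ) → ((𝒦 j Z t φ).Λ → ℝ) → ℝ),
        (∀ j Z t φ Bf, 0 ≤ χY₀ j Z t φ Bf) → (∀ j Z t φ Bf, 0 ≤ χcP j Z t φ Bf) →
        ∀ (Dfam : (j : ℕ) → TDom 4 (N j) → Finset (TDom 4 (L * N j)) × Finset (TBond 4 M (L * N j)) →
            Finset (TDom 4 (L * N j)))
          (Vk : (j : ℕ) → (Z : TDom 4 (N j)) → (t : Finset (TDom 4 (L * N j)) × Finset (TBond 4 M (L * N j))) →
            (φ : (W j).Φ) → ℂ → TDom 4 (L * N j) → ((𝒦 j Z t φ).Λ → ℝ) → ℂ),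
        (∀ j Z, ∀ t ∈ terms L M Z, ∀ φ, φ ∈ (W j).sp2 Z → ∀ b ∈ ball (0 : ℂ) (α j), ∀ i i',
          DifferentiableOn ℂ (fun σ => (𝒦 j Z t φ).A2 σ b i i') {σ | ∀ i, σ i ∈ ball (0 : ℂ) (Real.exp (c.κ₁ + 1))}) →
        (∀ j Z, ∀ t ∈ terms L M Z, ∀ φ, φ ∈ (W j).sp2 Z → ∀ b ∈ ball (0 : ℂ) (α j), ∀ i i',
          DifferentiableOn ℂ (fun σ => (𝒦 j Z t φ).G2 σ b i i') {σ | ∀ i, σ i ∈ ball (0 : ℂ) (Real.exp (c.κ₁ + 1))}) →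
        (∀ j Z, ∀ t ∈ terms L M Z, ∀ φ, φ ∈ (W j).sp2 Z → ∀ Y Bf,
          DifferentiableOn ℂ (fun b => Vk j Z t φ b Y Bf) (ball (0 : ℂ) (α j))) →
        (∀ j Z t φ, Measurable (χY₀ j Z t φ)) → (∀ j Z t φ, Measurable (χcP j Z t φ)) →
        (∀ j Z, ∀ t ∈ terms L M Z, ∀ φ, φ ∈ (W j).sp2 Z → ∀ b ∈ ball (0 : ℂ) (α j), ∀ Y,
          Measurable (Vk j Z t φ b Y)) →
        (∀ j Z, ∀ t ∈ terms L M Z, ∀ φ, φ ∈ (W j).sp2 Z → ∀ b : ℂ, ‖b‖ ≤ α j → ∀ σ : TPt 4 (N j) → ℂ,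
          (∀ i, ‖σ i‖ ≤ Real.exp (c.κ₁ + 1)) → ((𝒦 j Z t φ).A2 σ b).IsSymm) →
        ∀ {w₂₀ : ℝ} (qP : (j : ℕ) → (Z : TDom 4 (N j)) → (t : Finset (TDom 4 (L * N j)) × Finset (TBond 4 M (L * N j))) →
            (φ : (W j).Φ) → ((𝒦 j Z t φ).Λ → ℝ) → ℝ),
        (∀ j Z t φ Bf, χY₀ j Z t φ Bf * χcP j Z t φ Bf ≤
          Real.exp (-(γ₂ / 2 * rP ^ 2 * (t.2.card : ℕ)) + γ₂ / 2 * qP j Z t φ Bf)) →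
        (∀ j Z t φ Bf, qP j Z t φ Bf ≤ Bf ⬝ᵥ Bf) →
        (∀ j Z, ∀ t ∈ terms L M Z, ∀ φ, φ ∈ (W j).sp2 Z → ∀ b ∈ ball (0 : ℂ) (α j),
          ∀ τ : TDom 4 (L * N j) → ℂ, (∀ Y, τ Y ∈ Uτ j Y) →
            ∀ Bf, ∑ Y ∈ Dfam j Z t, ‖τ Y‖ * ‖Vk j Z t φ b Y Bf‖ ≤ a₂₀ / 2 * (Bf ⬝ᵥ Bf) + w₂₀) →
        (∀ j, ∀ Z : TDom 4 (N j), w₂₀ ≤ w₀ * ((Z.1).card : ℝ)) →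
        (∀ j Z t φ, (𝒦 j Z t φ).m ≤ m) →
        (∀ j Z t φ, ∀ x : UT (Nf j), (Finset.univ.filter fun i => (𝒦 j Z t φ).locN i = x).card ≤ m) →
        (∀ j Z t φ, (Fintype.card (𝒦 j Z t φ).Λ : ℝ) ≤ nΛ * ((Z.1).card : ℝ)) →
        (∀ j Z t φ, (Fintype.card ((𝒦 j Z t φ).Λ ⊕ (𝒦 j Z t φ).C₀) : ℝ) ≤ nN * ((Z.1).card : ℝ)) →
        ∀ {H : (j : ℕ) → ℂ → TDom 4 (N j) → (W j).Φ → ℂ},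
        (∀ j, ∀ b ∈ ball (0 : ℂ) (α j), ∀ (Z : TDom 4 (N j)) (φ : (W j).Φ), φ ∈ (W j).sp2 Z →
          H j b Z φ = ∑ t ∈ terms L M Z,
            term214 r (lZ j Z t) (lD j t) (core214 (fun σ => (𝒦 j Z t φ).A2 σ b) (Γ j Z t φ b)
              (F214 t.2.card (χY₀ j Z t φ) (χcP j Z t φ) (Dfam j Z t) (Vk j Z t φ b))) 0 0) →
        (∀ j, ∀ X Z : TDom 4 (N j), ∀ φ, Z.1 ⊆ X.1 → φ ∈ (W j).sp2 X → φ ∈ (W j).sp2 Z) →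
        ∀ {E : (j : ℕ) → ℂ → TDom 4 (N j) → (W j).Φ → ℂ},
        (∀ j, ∀ b ∈ ball (0 : ℂ) (α j), ∀ (X : TDom 4 (N j)) (φ : (W j).Φ), φ ∈ (W j).sp2 X →
          E j b X φ = locE (TTouch (d := 4) (N := N j)) (fun Z : TDom 4 (N j) => Z.1) (fun Z => H j b Z φ) X.1) →
        ∀ W' : Set (ℕ → ℝ),
        NE5 (C := torusCarriers N W) (reFunctional N W fun j => E j 0) (reFunctional N W fun j => E j 1) W'
          ((1 - 10 * c.δ) * ((c.L : ℝ) / 2) * c.κ) θ (2 * (c.A₂ * c.C3act * c.ε₁) / s) :=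
  ne5_of_structural_data_usable numerics_nonvacuous_pos hKΓ hKE hKC hε hκ m hnΛ hnN hθ hs Rσ₀

end Summit.QuantumFields.BalabanUV.T4Continuum.Spine.NE5.TwoRunTorusNE5Usable

end
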